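import Literature.MathematicalPhysics.QuantumFieldTheory.Balaban1983to89.B13WalksOfB9FactorsReading
import Literature.MathematicalPhysics.QuantumFieldTheory.Balaban1983to89.B9RWSumsDefinitePins

/-!
# BalabanUVNodes ∕ N10 ([B13], `Dag.B13_main`) ← N06 ([B9], `Dag.B9_main`): NODE A's ENTRY LETTERS FOR THE PIECE `G_k(U)` OF `Δ_k`
# FROM N06's CERTIFICATE OF RECORD, AT ITS RECORD FACE (def-Y's members `geo9Y x`), BY NAME

Track A of `YM-PLAN.md` (cell `pub-ymgap`, HUMAN RULING D-0062), DAG in-edge **N06 → N10** — [Balaban1988RG2Cluster] p. 13: *"This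
construction was discussed in [13] for all operators determining Δ_k"*, [13] = [Balaban1985BackgroundPropagators] Thm 3.10 pp. 414–416;
seat `pub-ymgap-dag-n10-c` g11, module 55, file B.  A HELPER for the N10 junction editions of this lineage (`…N10AtRecord11B13WalksBlockEntrywise`
binder `hEL`; `…WalksBlockRealSlice` ∕ `…N10B13KernelTowerWalksRealSlice` real-slice letters) — the N06-FACE half of the edge.

WHAT.  Node N06's certificate of record (`…N06AtOpsYNuOfRecordV6EPairM*`, editions 12–14; its helper `…N06G0LayerFromThm310AtPins(B)`,
theorem `g0_layer_of_thm310_letters`) DISPLAYS Theorem 3.10 for Bałaban's `G(U)` at def-Y's members `x : MemberY …` (geometry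
`B9PinMembersKLevelV1.geo9Y x`) as HYPOTHESIS SCHEMAS in a fixed binder shape: one side's primitive constants `q : PinPrims` with signs
`hq : q.OK`; the letters `𝔬A x : Ops310 (geo9Y x) (bg x) …`; the static data `hstA : ∀ x, StaticOK310 (𝔬A x) q.ρ q.Nc q.N' q.NF q.Cℓ (κA x)`
and Leibniz sizes `hκA : ∀ x, (κA x).Bounded q.Kc`; and
`h36A : ∀ x, q.M₁ ≤ (geo9Y x).M → ∀ α₀ > 0, c₃₅·(geo9Y x).M·α₀ ≤ q.a₁ → ∀ U, (bg x).Reg335 c₃₅ α₀ U →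
   Local342G (𝔬A x) 1 (H x) q.B₀ q.δ₀ U ∧ Factors389 (𝔬A x) 1 (H x) q.θ₀ q.δ₀ U ∧ Identities310 (𝔬A x) 1 (H x) U`.
THIS FILE takes those binders VERBATIM (nothing of N06 restated: whatever N06 proves lands in that shape) and derives, per member in the
regime «M ≥ M₀, (geo9Y x).M·α₀ ≤ q.a₁∕c₃₅» and for every background of the class (3.35), node N10's NODE-A input for the piece `G_k(U)`:
the ENTRYWISE (3.108)-letters `B13EntrywiseWalks.RawEntryLetters` of `M(G(U))` on the [B13] torus (module 55A `B13WalksOfB9FactorsReading`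
along a LOCATED READING `loc x : (geo9Y x).Site → UT Nf` of def-Y's index bonds — NODE 00's dictionary, displayed here, census class A0),
their joint walk expansion (module 31), and the REAL-SLICE letters of the complexified `Δ_a ↦ Δ_a⁻¹ = G` along a real family of
backgrounds valued in the class (3.35) ([B9] Thm 3.4's shape; module 38).  Recipe per member = N06's own (`g0_layer_of_thm310_letters`
ll. 255–334): [4] (2.61) at def-Y's members above ONE threshold (`B9RWSums347DefiniteFaces.lemma21Pack_geo9Y` — or displayed as `h261`),
«M sufficiently large» as `M ≥ 2N_Fθ₀c₁`, ONE call of n06-k's `conv3107_of_local3107` (inside 55A §3).  At the certificate of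
record (edition 14 `…V6EPairMU`, l.345) the generic `bg`, `c35` here are `bg9Y 𝔸 G`, `c35Y` — the same instantiation it gives N06's helper.
* §1 ★★ `rawEntryLetters_G_at_member` — POINTWISE, ∃-free: above the explicit threshold `max q.M₁ (max M_L (max 1 (2q.N_F q.θ₀ c₁(d_q))))`
  (`d_q = exp261 geo9Y q.δ₀ q.α`, `M_L` the (2.61) threshold of the displayed `h261`), for `0 < α₀`, `(geo9Y x).M·α₀ ≤ q.a₁∕c₃₅`, every
  `U ∈ Reg335 c₃₅ α₀`: `RawEntryLetters (fun _ ↦ M((𝔬A x).G U)) (loc x ∘ (𝔬A x).blk) R (((1−2q.α)q.δ₀)·sℓ x) (q.C d_q · (ℓmax x)²)`;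
  ★★ `rawEntryLetters_G_at_members` — the ∃M₀-form with `h261` DISCHARGED by `lemma21Pack_geo9Y` (N06's binder list literally, plus the reading);
  `jointWalkExpansion_G_at_member` — then module 31's `jointWalkExpansion_rawEntrywise` (σ-free, u-constant JWE through any non-empty X).
* §2 ★★ `rawEntryLetters_inv_at_member_realSlice` (+ `_radii`) — per member and `α₀`: a real structure `ℛ` on the configuration space, a REAL
  FAMILY `Uv : E → (bg x).Cfg` with `Uv v ∈ Reg335 c₃₅ α₀` at every real `v` of the ball (print: Thms 3.1–3.10 are uniform over the class
  (3.35)), the complexified `Δ_a` (`hslice`, holomorphy, ONE accretivity margin — [B9] Thm 3.4 ∕ [II] p. 15, displayed) ⟹ the real-slice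
  letter of `u ↦ A(u)⁻¹` with genuine `u`-dependence (55A §4); `rawEntryLetters_G_at_member_realSlice` — the direct road.
HONEST FRAMING.  Kernel bookkeeping (thresholds + one application of 55A per member); COUNT-NEUTRAL; nothing of [B9] or [II] asserted:
Theorem 3.10's estimates for Bałaban's `G(U)` remain N06's displayed schemas `h36A` (GAPS G-B9-05∕06a∕07), the reading `loc ∕ sℓ ∕ ℓmax` is
NODE 00's dictionary (def-Y's index bonds ↔ def-B13's torus locations `locΛ`; displayed, not chosen), the complexification data are the
[II] p. 15 in-edge; def-B13's assembly of `Δ_k` from `G_k(U)` (class A0) and the `C`-sandwich ∕ `s`-decoration (modules 23∕24) are untouched;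
dag-n10-d's ₁₃ pin algebra is not restated (PIN-ALGEBRA ONE-DECLARER).  NEITHER N06 NOR N10 IS DISCHARGED.  One finite 𝕋⁴ programme at
fixed `ε` — NOT continuum, NOT OS, NOT the mass gap ∕ Clay.  0 `def`, 0 `sorry`, standard axioms.
-/

noncomputable section

namespace Summit.QuantumFields.YangMills.BalabanUVNodes.N10EntryLettersOfN06RecordFace

open Metric Set
open scoped Matrix
open Literature.MathematicalPhysics.QuantumFieldTheory.Balaban1983to89
open Literature.MathematicalPhysics.QuantumFieldTheory.Balaban1983to89.B6RandomWalk (Ineq261)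
open Literature.MathematicalPhysics.QuantumFieldTheory.Balaban1983to89.B9Thm34Ext (toB6)
open Literature.MathematicalPhysics.QuantumFieldTheory.Balaban1983to89.B9Thm37GlueTorus (tdist1)
open Literature.MathematicalPhysics.QuantumFieldTheory.Balaban1983to89.B5TorusCover (UT)
open Literature.MathematicalPhysics.QuantumFieldTheory.Balaban1983to89.TreeLengthTorus (TPt)
open Literature.MathematicalPhysics.QuantumFieldTheory.Balaban1983to89.B9Thm310Whole
  (Ops310 StaticOK310 Sizes310 Local342G Identities310 Conv3107 conv3107_of_local3107)
open Literature.MathematicalPhysics.QuantumFieldTheory.Balaban1983to89.B9RWSumsDefinitePins (PinPrims)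
open Literature.MathematicalPhysics.QuantumFieldTheory.Balaban1983to89.B9RWSums347DefiniteFaces (exp261 lemma21Pack_geo9Y)
open Literature.MathematicalPhysics.QuantumFieldTheory.Balaban1983to89.B9PinMembersKLevelV1 (MemberY geo9Y)
open Literature.MathematicalPhysics.QuantumFieldTheory.Balaban1983to89.B9GeoLemma21KLevelV1 (geo9Y_len_pos)
open Literature.MathematicalPhysics.QuantumFieldTheory.Balaban1983to89.B13JointWalkExpansion (JointWalkExpansion)
open Literature.MathematicalPhysics.QuantumFieldTheory.Balaban1983to89.B13EntrywiseWalks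
  (RawEntryLetters rawEntryTerm entryDist jointWalkExpansion_rawEntrywise)
open Literature.MathematicalPhysics.QuantumFieldTheory.Balaban1983to89.B13RealSliceEntryLetters (RealStructure lam)
open Literature.MathematicalPhysics.QuantumFieldTheory.Balaban1983to89.B13WalksOfB9FactorsReading
  (rawEntryLetters_G_of_local3107_reading rawEntryLetters_G_of_conv3107_realSlice_reading
    rawEntryLetters_inv_of_conv3107_realSlice_reading)

variable {d ℓ : ℕ} {hd : 1 ≤ d + 1} {hL : Odd (ℓ + 1) ∧ 1 < ℓ + 1} {b₀ b₁ : ℝ} {Mstar : ℕ}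
variable [∀ x : MemberY d ℓ hd hL b₀ b₁ Mstar, Fintype (geo9Y x).Site]
  [∀ x : MemberY d ℓ hd hL b₀ b₁ Mstar, DecidableEq (geo9Y x).Site]
variable {c35 : ℝ} {bg : MemberY d ℓ hd hL b₀ b₁ Mstar → B9.Backgrounds}
variable {X Y ι A : MemberY d ℓ hd hL b₀ b₁ Mstar → Type}
  [∀ x, Fintype (X x)] [∀ x, DecidableEq (X x)] [∀ x, Fintype (Y x)] [∀ x, DecidableEq (Y x)] [∀ x, Fintype (ι x)]
  [∀ x, Fintype (A x)]
variable {ν : ℕ} {Nf : Fin ν → ℕ} [∀ i, NeZero (Nf i)]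
variable {E : Type*} [NormedAddCommGroup E] [NormedSpace ℂ E]

/-- «for M sufficiently large»: M ≧ 2N_Fθ₀c₁ gives N_F·θ₀M⁻¹·c₁ ≦ ½ (the located smallness of `conv3107_of_local3107`; N06's private arithmetic,
restated). [folklore] -/
private theorem small_of_threshold {NF θ₀ c M : ℝ} (hM : 0 < M) (hbig : 2 * NF * θ₀ * c ≤ M) :
    NF * (θ₀ * M⁻¹) * c ≤ 1 / 2 := by
  have h1 : NF * (θ₀ * M⁻¹) * c = (NF * θ₀ * c) / M := by
    rw [div_eq_mul_inv]
    ring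
  rw [h1, div_le_iff₀ hM]
  linarith

/-! ## §1. The entry letters of `G(U)` at a member, from N06's displayed Theorem-3.10 schemas -/

/-- ★★ **NODE A's ENTRY LETTER FOR `G_k(U)` AT ONE MEMBER OF N06's RECORD, FROM N06's DISPLAYED SCHEMAS — POINTWISE FORM.**  Inputs
VERBATIM from N06's certificate: `q hq H 𝔬A κA hstA hκA h36A`; [4] (2.61) at exponent `exp261 geo9Y q.δ₀ q.α` above a threshold `M_L`
DISPLAYED (`h261` — N06 discharges it by `lemma21Pack_geo9Y`, as does §1's ∃-form below); the located reading of the member's index bonds on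
the [B13] torus (`loc x`, contraction scale `sℓ x`, length bound `ℓmax x` — NODE 00's dictionary).  Conclusion: above the EXPLICIT threshold
`max q.M₁ (max M_L (max 1 (2·q.N_F·q.θ₀·c₁)))`, for `0 < α₀`, `(geo9Y x).M·α₀ ≤ q.a₁∕c₃₅` and every background `U` of the class (3.35),
`M((𝔬A x).G U)` read in ℂ is a `RawEntryLetters` datum on every ball: locations `loc x ∘ (𝔬A x).blk`, rate `((1−2q.α)q.δ₀)·sℓ x`, constant
`q.C d_q · (ℓmax x)²` (55A §3: one call of n06-k's `conv3107_of_local3107`, then the [4]-(2.51) majorant read on the torus).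
[cite: Balaban1985BackgroundPropagators, Thm 3.10 (3.105)–(3.108) pp.414–416, (3.35) p.396, Cor. 3.6 p.408; Balaban1984PropagatorsII, Lemma 2.1 (2.61) p.234, (2.51) p.232; Balaban1988RG2Cluster, p.13, (2.16) p.16] -/
theorem rawEntryLetters_G_at_member (hc35 : 0 < c35) (q : PinPrims) (hq : q.OK) (H : MemberY d ℓ hd hL b₀ b₁ Mstar → Prop)
    -- N06's Theorem-3.10 letters and schemas (G side), VERBATIM as the certificate displays them
    (𝔬A : ∀ x : MemberY d ℓ hd hL b₀ b₁ Mstar, Ops310 (geo9Y x) (bg x) (X x) (Y x) (ι x) (A x))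
    (κA : MemberY d ℓ hd hL b₀ b₁ Mstar → Sizes310)
    (hstA : ∀ x, StaticOK310 (𝔬A x) q.ρ q.Nc q.N' q.NF q.Cℓ (κA x)) (hκA : ∀ x, (κA x).Bounded q.Kc)
    (h36A : ∀ x, q.M₁ ≤ (geo9Y x).M → ∀ α₀ : ℝ, 0 < α₀ → c35 * (geo9Y x).M * α₀ ≤ q.a₁ →
      ∀ U : (bg x).Cfg, (bg x).Reg335 c35 α₀ U →
        Local342G (𝔬A x) 1 (H x) q.B₀ q.δ₀ U ∧ B9Thm310Whole.Factors389 (𝔬A x) 1 (H x) q.θ₀ q.δ₀ U ∧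
          Identities310 (𝔬A x) 1 (H x) U)
    -- [4] Lemma 2.1 (2.61) at def-Y's members above one threshold (N06: `lemma21Pack_geo9Y`)
    {ML : ℝ} (h261 : ∀ x, ML ≤ (geo9Y x).M →
      Ineq261 (exp261 (@geo9Y d ℓ hd hL b₀ b₁ Mstar) q.δ₀ q.α) (toB6 (geo9Y x) 1 (H x)) q.δ₀ q.α)
    -- the located reading of def-Y's index bonds on the [B13] torus (NODE 00's dictionary; displayed, not chosen here)
    (loc : ∀ x : MemberY d ℓ hd hL b₀ b₁ Mstar, (geo9Y x).Site → UT Nf) (sℓ ℓmax : MemberY d ℓ hd hL b₀ b₁ Mstar → ℝ)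
    (hloc : ∀ x a b, sℓ x * tdist1 Nf (loc x a) (loc x b) ≤ (geo9Y x).dist a b)
    (hlen : ∀ x a, (geo9Y x).len a ≤ ℓmax x)
    -- the member, its regime, the background
    (x : MemberY d ℓ hd hL b₀ b₁ Mstar)
    (hM : max q.M₁ (max ML (max 1 (2 * q.NF * q.θ₀ * B6.c1 (exp261 (@geo9Y d ℓ hd hL b₀ b₁ Mstar) q.δ₀ q.α) q.δ₀ q.α))) ≤
      (geo9Y x).M)
    {α₀ : ℝ} (hα : 0 < α₀) (ha : (geo9Y x).M * α₀ ≤ q.a₁ / c35) (U : (bg x).Cfg) (hU : (bg x).Reg335 c35 α₀ U) (Rball : ℝ) :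
    RawEntryLetters (Nf := Nf) (fun (_ : E) => (LinearMap.toMatrix' ((𝔬A x).G U)).map (algebraMap ℝ ℂ)) (loc x ∘ (𝔬A x).blk)
      Rball (((1 - 2 * q.α) * q.δ₀) * sℓ x) (q.C (exp261 (@geo9Y d ℓ hd hL b₀ b₁ Mstar) q.δ₀ q.α) * ℓmax x ^ 2) := by
  -- the member's regime: above every threshold, below the smallness bound
  have hMq : q.M₁ ≤ (geo9Y x).M := le_trans (le_max_left _ _) hM
  have hMLx : ML ≤ (geo9Y x).M := le_trans ((le_max_left _ _).trans (le_max_right _ _)) hM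
  have hM1 : 1 ≤ (geo9Y x).M := le_trans (((le_max_left _ _).trans (le_max_right _ _)).trans (le_max_right _ _)) hM
  have hbig : 2 * q.NF * q.θ₀ * B6.c1 (exp261 (@geo9Y d ℓ hd hL b₀ b₁ Mstar) q.δ₀ q.α) q.δ₀ q.α ≤ (geo9Y x).M :=
    le_trans (((le_max_right _ _).trans (le_max_right _ _)).trans (le_max_right _ _)) hM
  have hMpos : 0 < (geo9Y x).M := lt_of_lt_of_le one_pos hM1
  have haq : c35 * (geo9Y x).M * α₀ ≤ q.a₁ := by
    have h1 : c35 * ((geo9Y x).M * α₀) ≤ c35 * (q.a₁ / c35) := mul_le_mul_of_nonneg_left ha hc35.le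
    rw [mul_div_cancel₀ _ hc35.ne'] at h1
    simpa only [mul_assoc] using h1
  have hq' : q.NF * (q.θ₀ * (geo9Y x).M⁻¹) * B6.c1 (exp261 (@geo9Y d ℓ hd hL b₀ b₁ Mstar) q.δ₀ q.α) q.δ₀ q.α ≤ 1 / 2 :=
    small_of_threshold hMpos hbig
  obtain ⟨hl, hf, hi⟩ := h36A x hMq α₀ hα haq U hU
  -- Theorem 3.10's conclusion for `G(U)` from the schemas (n06-k), read on the torus along the member's reading (55A §3)
  exact rawEntryLetters_G_of_local3107_reading (𝔬A x) (exp261 (@geo9Y d ℓ hd hL b₀ b₁ Mstar) q.δ₀ q.α) hq.B₀_pos.le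
    hq.δ₀_pos.le hq.α_pos.le hq.α_lt.le hq.Nc_nn hq.N'_nn hq.NF_nn hq.one_le_Cℓ hq.Kc_nn hq.θ₀_nn hMpos (hstA x) (hκA x)
    (h261 x hMLx) hq' hl hf hi (hlen x) (loc x) (hloc x) Rball

/-- ★★ **THE SAME FROM N06's BINDER LIST LITERALLY — the (2.61) threshold DISCHARGED** (`lemma21Pack_geo9Y`: [4] Lemma 2.1 holds at
def-Y's members above one threshold with NO hypothesis on the geometry): there is `M₀ ≥ q.M₁` such that at every member with
`(geo9Y x).M ≥ M₀`, for `0 < α₀`, `(geo9Y x).M·α₀ ≤ q.a₁∕c₃₅` and every `U ∈ Reg335 c₃₅ α₀`, `M(G(U))` is N10's `RawEntryLetters` datum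
as in the pointwise form, on every ball of every configuration space. [cite: Balaban1985BackgroundPropagators, Thm 3.10 (3.105)–(3.108) pp.414–416, (3.35) p.396; Balaban1984PropagatorsII, Lemma 2.1 (2.61) p.234; Balaban1988RG2Cluster, p.13, (2.16) p.16] -/
theorem rawEntryLetters_G_at_members (hc35 : 0 < c35) (q : PinPrims) (hq : q.OK) (H : MemberY d ℓ hd hL b₀ b₁ Mstar → Prop)
    (𝔬A : ∀ x : MemberY d ℓ hd hL b₀ b₁ Mstar, Ops310 (geo9Y x) (bg x) (X x) (Y x) (ι x) (A x))
    (κA : MemberY d ℓ hd hL b₀ b₁ Mstar → Sizes310)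
    (hstA : ∀ x, StaticOK310 (𝔬A x) q.ρ q.Nc q.N' q.NF q.Cℓ (κA x)) (hκA : ∀ x, (κA x).Bounded q.Kc)
    (h36A : ∀ x, q.M₁ ≤ (geo9Y x).M → ∀ α₀ : ℝ, 0 < α₀ → c35 * (geo9Y x).M * α₀ ≤ q.a₁ →
      ∀ U : (bg x).Cfg, (bg x).Reg335 c35 α₀ U →
        Local342G (𝔬A x) 1 (H x) q.B₀ q.δ₀ U ∧ B9Thm310Whole.Factors389 (𝔬A x) 1 (H x) q.θ₀ q.δ₀ U ∧
          Identities310 (𝔬A x) 1 (H x) U)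
    (loc : ∀ x : MemberY d ℓ hd hL b₀ b₁ Mstar, (geo9Y x).Site → UT Nf) (sℓ ℓmax : MemberY d ℓ hd hL b₀ b₁ Mstar → ℝ)
    (hloc : ∀ x a b, sℓ x * tdist1 Nf (loc x a) (loc x b) ≤ (geo9Y x).dist a b)
    (hlen : ∀ x a, (geo9Y x).len a ≤ ℓmax x) :
    ∃ M₀ : ℝ, q.M₁ ≤ M₀ ∧ 0 < M₀ ∧
      ∀ x : MemberY d ℓ hd hL b₀ b₁ Mstar, M₀ ≤ (geo9Y x).M → ∀ α₀ : ℝ, 0 < α₀ → (geo9Y x).M * α₀ ≤ q.a₁ / c35 →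
        ∀ U : (bg x).Cfg, (bg x).Reg335 c35 α₀ U → ∀ (E : Type) [NormedAddCommGroup E] [NormedSpace ℂ E] (Rball : ℝ),
          RawEntryLetters (Nf := Nf) (fun (_ : E) => (LinearMap.toMatrix' ((𝔬A x).G U)).map (algebraMap ℝ ℂ))
            (loc x ∘ (𝔬A x).blk) Rball (((1 - 2 * q.α) * q.δ₀) * sℓ x)
            (q.C (exp261 (@geo9Y d ℓ hd hL b₀ b₁ Mstar) q.δ₀ q.α) * ℓmax x ^ 2) := by
  -- [4] Lemma 2.1 (2.61) at (δ₀, α) above ONE threshold M_L (n06-i ∕ n06-k)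
  obtain ⟨ML, h261, -, -⟩ :=
    lemma21Pack_geo9Y (d := d) (ℓ := ℓ) (hd := hd) (hL := hL) (b₀ := b₀) (b₁ := b₁) (Mstar := Mstar) H hq.α_pos hq.α_lt
      hq.δ₀_pos hq.αF_pos (by linarith [hq.αF_lt])
  refine ⟨max q.M₁ (max ML (max 1 (2 * q.NF * q.θ₀ * B6.c1 (exp261 (@geo9Y d ℓ hd hL b₀ b₁ Mstar) q.δ₀ q.α) q.δ₀ q.α))),
    le_max_left _ _, lt_of_lt_of_le hq.M₁_pos (le_max_left _ _), fun x hM α₀ hα ha U hU E _ _ Rball => ?_⟩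
  exact rawEntryLetters_G_at_member hc35 q hq H 𝔬A κA hstA hκA h36A h261 loc sℓ ℓmax hloc hlen x hM hα ha U hU Rball

/-- **THE JOINT WALK EXPANSION OF `G(U)` AT A MEMBER** (σ-free, configuration-constant, through any non-empty `X` of the torus): the
pointwise letters §1 packaged entrywise by module 31 `jointWalkExpansion_rawEntrywise` (one term per matrix entry, through-set `∅`,
reduced rate `ε`, packaging length `L_w` with `|X × X| ≤ (ρ − ε)·L_w`, fibre bound `m` of the located block map) — the input shape of the
junction editions `…WalksBlockSigmaFree` (after def-B13's `C`-sandwich and `s`-decoration, modules 23∕24, untouched here).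
[cite: Balaban1985BackgroundPropagators, Thm 3.10 (3.107)–(3.108) p.416; Balaban1988RG2Cluster, p.13, p.15, (2.16) p.16] -/
theorem jointWalkExpansion_G_at_member (hc35 : 0 < c35) (q : PinPrims) (hq : q.OK) (H : MemberY d ℓ hd hL b₀ b₁ Mstar → Prop)
    (𝔬A : ∀ x : MemberY d ℓ hd hL b₀ b₁ Mstar, Ops310 (geo9Y x) (bg x) (X x) (Y x) (ι x) (A x))
    (κA : MemberY d ℓ hd hL b₀ b₁ Mstar → Sizes310)
    (hstA : ∀ x, StaticOK310 (𝔬A x) q.ρ q.Nc q.N' q.NF q.Cℓ (κA x)) (hκA : ∀ x, (κA x).Bounded q.Kc)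
    (h36A : ∀ x, q.M₁ ≤ (geo9Y x).M → ∀ α₀ : ℝ, 0 < α₀ → c35 * (geo9Y x).M * α₀ ≤ q.a₁ →
      ∀ U : (bg x).Cfg, (bg x).Reg335 c35 α₀ U →
        Local342G (𝔬A x) 1 (H x) q.B₀ q.δ₀ U ∧ B9Thm310Whole.Factors389 (𝔬A x) 1 (H x) q.θ₀ q.δ₀ U ∧
          Identities310 (𝔬A x) 1 (H x) U)
    {ML : ℝ} (h261 : ∀ x, ML ≤ (geo9Y x).M →
      Ineq261 (exp261 (@geo9Y d ℓ hd hL b₀ b₁ Mstar) q.δ₀ q.α) (toB6 (geo9Y x) 1 (H x)) q.δ₀ q.α)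
    (loc : ∀ x : MemberY d ℓ hd hL b₀ b₁ Mstar, (geo9Y x).Site → UT Nf) (sℓ ℓmax : MemberY d ℓ hd hL b₀ b₁ Mstar → ℝ)
    (hloc : ∀ x a b, sℓ x * tdist1 Nf (loc x a) (loc x b) ≤ (geo9Y x).dist a b)
    (hlen : ∀ x a, (geo9Y x).len a ≤ ℓmax x)
    (x : MemberY d ℓ hd hL b₀ b₁ Mstar)
    (hM : max q.M₁ (max ML (max 1 (2 * q.NF * q.θ₀ * B6.c1 (exp261 (@geo9Y d ℓ hd hL b₀ b₁ Mstar) q.δ₀ q.α) q.δ₀ q.α))) ≤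
      (geo9Y x).M)
    {α₀ : ℝ} (hα : 0 < α₀) (ha : (geo9Y x).M * α₀ ≤ q.a₁ / c35) (U : (bg x).Cfg) (hU : (bg x).Reg335 c35 α₀ U) (Rball : ℝ)
    (c : B13.Consts) {dσ Nσ : ℕ} (Xσ : Finset (UT Nf)) (hXσ : Xσ.Nonempty)
    {m : ℕ} (hfib : ∀ y : UT Nf, (Finset.univ.filter fun k => (loc x ∘ (𝔬A x).blk) k = y).card ≤ m)
    {ε kap Lw : ℝ} (hε : ε < ((1 - 2 * q.α) * q.δ₀) * sℓ x) (hkap : kap ≤ ((1 - 2 * q.α) * q.δ₀) * sℓ x - ε)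
    (hLw0 : 0 ≤ Lw) (hLw : (Fintype.card (X x × X x) : ℝ) ≤ (((1 - 2 * q.α) * q.δ₀) * sℓ x - ε) * Lw) :
    JointWalkExpansion c (loc x ∘ (𝔬A x).blk) (loc x ∘ (𝔬A x).blk)
      (fun (_ : TPt dσ Nσ → ℂ) (_ : E) => (LinearMap.toMatrix' ((𝔬A x).G U)).map (algebraMap ℝ ℂ)) Xσ Rball ε kap
      ((q.C (exp261 (@geo9Y d ℓ hd hL b₀ b₁ Mstar) q.δ₀ q.α) * ℓmax x ^ 2) * (m * m + 1))
      (fun ω (_ : TPt dσ Nσ → ℂ) => rawEntryTerm (fun (_ : E) => (LinearMap.toMatrix' ((𝔬A x).G U)).map (algebraMap ℝ ℂ)) ω)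
      (∅ : Set (X x × X x)) (fun _ => q.C (exp261 (@geo9Y d ℓ hd hL b₀ b₁ Mstar) q.δ₀ q.α) * ℓmax x ^ 2)
      (entryDist (loc x ∘ (𝔬A x).blk) Xσ hXσ Lw) (((1 - 2 * q.α) * q.δ₀) * sℓ x) :=
  jointWalkExpansion_rawEntrywise c hXσ
    (rawEntryLetters_G_at_member hc35 q hq H 𝔬A κA hstA hκA h36A h261 loc sℓ ℓmax hloc hlen x hM hα ha U hU Rball) hε hkap
    hLw0 hLw hfib

/-! ## §2. The real slice at a member: the complexified `Δ_a ↦ G = Δ_a⁻¹` along a real family in the class (3.35) -/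

/-- ★★ **NODE A's REAL-SLICE LETTER FOR THE INVERSE AT ONE MEMBER, FROM N06's DISPLAYED SCHEMAS** ([B9] Thm 3.4's shape).  N06's binders as
in §1 (+ `h261`); the member's regime and `α₀`; a real structure `ℛ` on the configuration space `E`; a REAL FAMILY of backgrounds
`Uv : E → (bg x).Cfg` with `Uv v ∈ Reg335 c₃₅ α₀` at every real `v` of the ball `‖v‖ < R_an` (print: (3.35) is the class over which
Thms 3.1–3.10 are uniform); the complexified operator `A : E → Matrix (X x) (X x) ℂ`, entrywise holomorphic and `m_A`-accretive on the ball,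
which at every real `v` IS `M((𝔬A x).Δa (Uv v))` (`hslice` — NODE 00's dictionary); `0 < r < 1`.  Then `u ↦ A(u)⁻¹` is a `RawEntryLetters`
datum on `‖u‖ < (r∕(1+r))R_an` with locations `loc x ∘ (𝔬A x).blk`, rate `(1 − λ(r))·(((1−2q.α)q.δ₀)·sℓ x)` and constant
`B^{1−λ(r)}·(max B (2∕m_A))^{λ(r)}`, `B = q.C d_q·(ℓmax x)²` — node N10's real-slice junction input (`…WalksBlockRealSlice`,
`…N10B13KernelTowerWalksRealSlice`) for the `G_k`-piece with genuine `u`-dependence (55A §4 at N06's conclusion per real `v`).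
[cite: Balaban1985BackgroundPropagators, (3.24)–(3.27) pp.394–395, (3.35) p.396, Thm 3.4 p.400, Thm 3.10 (3.105)–(3.108) pp.414–416;
Balaban1988RG2Cluster, p.13, p.15; Ransford1995, Thm. 4.3.7] -/
theorem rawEntryLetters_inv_at_member_realSlice (hc35 : 0 < c35) (q : PinPrims) (hq : q.OK)
    (H : MemberY d ℓ hd hL b₀ b₁ Mstar → Prop)
    (𝔬A : ∀ x : MemberY d ℓ hd hL b₀ b₁ Mstar, Ops310 (geo9Y x) (bg x) (X x) (Y x) (ι x) (A x))
    (κA : MemberY d ℓ hd hL b₀ b₁ Mstar → Sizes310)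
    (hstA : ∀ x, StaticOK310 (𝔬A x) q.ρ q.Nc q.N' q.NF q.Cℓ (κA x)) (hκA : ∀ x, (κA x).Bounded q.Kc)
    (h36A : ∀ x, q.M₁ ≤ (geo9Y x).M → ∀ α₀ : ℝ, 0 < α₀ → c35 * (geo9Y x).M * α₀ ≤ q.a₁ →
      ∀ U : (bg x).Cfg, (bg x).Reg335 c35 α₀ U →
        Local342G (𝔬A x) 1 (H x) q.B₀ q.δ₀ U ∧ B9Thm310Whole.Factors389 (𝔬A x) 1 (H x) q.θ₀ q.δ₀ U ∧
          Identities310 (𝔬A x) 1 (H x) U)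
    {ML : ℝ} (h261 : ∀ x, ML ≤ (geo9Y x).M →
      Ineq261 (exp261 (@geo9Y d ℓ hd hL b₀ b₁ Mstar) q.δ₀ q.α) (toB6 (geo9Y x) 1 (H x)) q.δ₀ q.α)
    (loc : ∀ x : MemberY d ℓ hd hL b₀ b₁ Mstar, (geo9Y x).Site → UT Nf) (sℓ ℓmax : MemberY d ℓ hd hL b₀ b₁ Mstar → ℝ)
    (hsℓ : ∀ x, 0 ≤ sℓ x) (hloc : ∀ x a b, sℓ x * tdist1 Nf (loc x a) (loc x b) ≤ (geo9Y x).dist a b)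
    (hlen : ∀ x a, (geo9Y x).len a ≤ ℓmax x)
    (x : MemberY d ℓ hd hL b₀ b₁ Mstar)
    (hM : max q.M₁ (max ML (max 1 (2 * q.NF * q.θ₀ * B6.c1 (exp261 (@geo9Y d ℓ hd hL b₀ b₁ Mstar) q.δ₀ q.α) q.δ₀ q.α))) ≤
      (geo9Y x).M)
    {α₀ : ℝ} (hα : 0 < α₀) (ha : (geo9Y x).M * α₀ ≤ q.a₁ / c35)
    -- the real family of backgrounds in the class (3.35) and the complexified `Δ_a` on the configuration ball
    (ℛ : RealStructure E) (Uv : E → (bg x).Cfg) {Ran mA r : ℝ}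
    (hUv : ∀ v ∈ ℛ.Ereal, ‖v‖ < Ran → (bg x).Reg335 c35 α₀ (Uv v))
    {Aop : E → Matrix (X x) (X x) ℂ}
    (hslice : ∀ v ∈ ℛ.Ereal, ‖v‖ < Ran → Aop v = (LinearMap.toMatrix' ((𝔬A x).Δa (Uv v))).map (algebraMap ℝ ℂ))
    (hA : ∀ i j, DifferentiableOn ℂ (fun u => Aop u i j) (ball (0 : E) Ran)) (hmA : 0 < mA)
    (hacc : ∀ u ∈ ball (0 : E) Ran, ∀ w : X x → ℂ, mA * ∑ i, ‖w i‖ ^ 2 ≤ (∑ i, star (w i) * (Aop u *ᵥ w) i).re)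
    (hr0 : 0 < r) (hr1 : r < 1) :
    RawEntryLetters (fun u => (Aop u)⁻¹) (loc x ∘ (𝔬A x).blk) (r / (1 + r) * Ran)
      ((1 - lam r) * ((((1 - 2 * q.α) * q.δ₀)) * sℓ x))
      ((q.C (exp261 (@geo9Y d ℓ hd hL b₀ b₁ Mstar) q.δ₀ q.α) * ℓmax x ^ 2) ^ (1 - lam r) *
        (max (q.C (exp261 (@geo9Y d ℓ hd hL b₀ b₁ Mstar) q.δ₀ q.α) * ℓmax x ^ 2) (2 / mA)) ^ lam r) := by
  -- the member's regime, as in §1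
  have hMq : q.M₁ ≤ (geo9Y x).M := le_trans (le_max_left _ _) hM
  have hMLx : ML ≤ (geo9Y x).M := le_trans ((le_max_left _ _).trans (le_max_right _ _)) hM
  have hM1 : 1 ≤ (geo9Y x).M := le_trans (((le_max_left _ _).trans (le_max_right _ _)).trans (le_max_right _ _)) hM
  have hbig : 2 * q.NF * q.θ₀ * B6.c1 (exp261 (@geo9Y d ℓ hd hL b₀ b₁ Mstar) q.δ₀ q.α) q.δ₀ q.α ≤ (geo9Y x).M :=
    le_trans (((le_max_right _ _).trans (le_max_right _ _)).trans (le_max_right _ _)) hM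
  have hMpos : 0 < (geo9Y x).M := lt_of_lt_of_le one_pos hM1
  have haq : c35 * (geo9Y x).M * α₀ ≤ q.a₁ := by
    have h1 : c35 * ((geo9Y x).M * α₀) ≤ c35 * (q.a₁ / c35) := mul_le_mul_of_nonneg_left ha hc35.le
    rw [mul_div_cancel₀ _ hc35.ne'] at h1
    simpa only [mul_assoc] using h1
  have hq' : q.NF * (q.θ₀ * (geo9Y x).M⁻¹) * B6.c1 (exp261 (@geo9Y d ℓ hd hL b₀ b₁ Mstar) q.δ₀ q.α) q.δ₀ q.α ≤ 1 / 2 :=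
    small_of_threshold hMpos hbig
  -- N06's conclusion `Conv3107` for `G(U_v)` at every REAL configuration of the ball (n06-k, from the displayed schemas)
  have hconv : ∀ v ∈ ℛ.Ereal, ‖v‖ < Ran →
      Conv3107 (𝔬A x) 1 (H x) (q.C (exp261 (@geo9Y d ℓ hd hL b₀ b₁ Mstar) q.δ₀ q.α)) ((1 - 2 * q.α) * q.δ₀) (Uv v) := by
    intro v hv hvR
    obtain ⟨hl, hf, hi⟩ := h36A x hMq α₀ hα haq (Uv v) (hUv v hv hvR)
    exact conv3107_of_local3107 (𝔬A x) 1 (H x) (exp261 (@geo9Y d ℓ hd hL b₀ b₁ Mstar) q.δ₀ q.α) q.δ₀ q.α q.ρ q.B₀ q.Nc q.N'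
      q.NF q.Cℓ q.Kc q.θ₀ (κA x) (Uv v) hq.B₀_pos.le hq.δ₀_pos.le hq.α_pos.le hq.α_lt.le hq.Nc_nn hq.N'_nn hq.NF_nn hq.one_le_Cℓ
      hq.Kc_nn hq.θ₀_nn hMpos (hstA x) (hκA x) (h261 x hMLx) hq' hl hf hi
  have hI : ∀ v ∈ ℛ.Ereal, ‖v‖ < Ran → Identities310 (𝔬A x) 1 (H x) (Uv v) :=
    fun v hv hvR => (h36A x hMq α₀ hα haq (Uv v) (hUv v hv hvR)).2.2
  exact rawEntryLetters_inv_of_conv3107_realSlice_reading (𝔬A x) ℛ Uv hconv hI (PinPrims.C_nonneg hq _)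
    (PinPrims.rate_pos hq).le (fun a => (geo9Y_len_pos x a).le) (hlen x) (loc x) (hsℓ x) (hloc x) hslice hA hmA hacc hr0 hr1

/-- **RADII EDITION** of the inverse road at a member: the consumer's radius `R₀ > 0` literally (`rf.R` of the junction), analyticity radius
`R_an > 2R₀` ([II] p. 15: «much bigger»), rate loss `λ(R₀∕(R_an − R₀)) ≤ (4∕π)·R₀∕(R_an − R₀)`.
[cite: Balaban1985BackgroundPropagators, Thm 3.4 p.400, Thm 3.10 (3.108) p.416; Balaban1988RG2Cluster, p.15; Balaban1987RG1, (1.13)–(1.14) p.262; Ransford1995, Thm. 4.3.7] -/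
theorem rawEntryLetters_inv_at_member_realSlice_radii (hc35 : 0 < c35) (q : PinPrims) (hq : q.OK)
    (H : MemberY d ℓ hd hL b₀ b₁ Mstar → Prop)
    (𝔬A : ∀ x : MemberY d ℓ hd hL b₀ b₁ Mstar, Ops310 (geo9Y x) (bg x) (X x) (Y x) (ι x) (A x))
    (κA : MemberY d ℓ hd hL b₀ b₁ Mstar → Sizes310)
    (hstA : ∀ x, StaticOK310 (𝔬A x) q.ρ q.Nc q.N' q.NF q.Cℓ (κA x)) (hκA : ∀ x, (κA x).Bounded q.Kc)
    (h36A : ∀ x, q.M₁ ≤ (geo9Y x).M → ∀ α₀ : ℝ, 0 < α₀ → c35 * (geo9Y x).M * α₀ ≤ q.a₁ →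
      ∀ U : (bg x).Cfg, (bg x).Reg335 c35 α₀ U →
        Local342G (𝔬A x) 1 (H x) q.B₀ q.δ₀ U ∧ B9Thm310Whole.Factors389 (𝔬A x) 1 (H x) q.θ₀ q.δ₀ U ∧
          Identities310 (𝔬A x) 1 (H x) U)
    {ML : ℝ} (h261 : ∀ x, ML ≤ (geo9Y x).M →
      Ineq261 (exp261 (@geo9Y d ℓ hd hL b₀ b₁ Mstar) q.δ₀ q.α) (toB6 (geo9Y x) 1 (H x)) q.δ₀ q.α)
    (loc : ∀ x : MemberY d ℓ hd hL b₀ b₁ Mstar, (geo9Y x).Site → UT Nf) (sℓ ℓmax : MemberY d ℓ hd hL b₀ b₁ Mstar → ℝ)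
    (hsℓ : ∀ x, 0 ≤ sℓ x) (hloc : ∀ x a b, sℓ x * tdist1 Nf (loc x a) (loc x b) ≤ (geo9Y x).dist a b)
    (hlen : ∀ x a, (geo9Y x).len a ≤ ℓmax x)
    (x : MemberY d ℓ hd hL b₀ b₁ Mstar)
    (hM : max q.M₁ (max ML (max 1 (2 * q.NF * q.θ₀ * B6.c1 (exp261 (@geo9Y d ℓ hd hL b₀ b₁ Mstar) q.δ₀ q.α) q.δ₀ q.α))) ≤
      (geo9Y x).M)
    {α₀ : ℝ} (hα : 0 < α₀) (ha : (geo9Y x).M * α₀ ≤ q.a₁ / c35)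
    (ℛ : RealStructure E) (Uv : E → (bg x).Cfg) {Ran R₀ mA : ℝ} (hR₀ : 0 < R₀) (h2 : 2 * R₀ < Ran)
    (hUv : ∀ v ∈ ℛ.Ereal, ‖v‖ < Ran → (bg x).Reg335 c35 α₀ (Uv v))
    {Aop : E → Matrix (X x) (X x) ℂ}
    (hslice : ∀ v ∈ ℛ.Ereal, ‖v‖ < Ran → Aop v = (LinearMap.toMatrix' ((𝔬A x).Δa (Uv v))).map (algebraMap ℝ ℂ))
    (hA : ∀ i j, DifferentiableOn ℂ (fun u => Aop u i j) (ball (0 : E) Ran)) (hmA : 0 < mA)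
    (hacc : ∀ u ∈ ball (0 : E) Ran, ∀ w : X x → ℂ, mA * ∑ i, ‖w i‖ ^ 2 ≤ (∑ i, star (w i) * (Aop u *ᵥ w) i).re) :
    RawEntryLetters (fun u => (Aop u)⁻¹) (loc x ∘ (𝔬A x).blk) R₀
      ((1 - lam (R₀ / (Ran - R₀))) * ((((1 - 2 * q.α) * q.δ₀)) * sℓ x))
      ((q.C (exp261 (@geo9Y d ℓ hd hL b₀ b₁ Mstar) q.δ₀ q.α) * ℓmax x ^ 2) ^ (1 - lam (R₀ / (Ran - R₀))) *
        (max (q.C (exp261 (@geo9Y d ℓ hd hL b₀ b₁ Mstar) q.δ₀ q.α) * ℓmax x ^ 2) (2 / mA)) ^ lam (R₀ / (Ran - R₀))) ∧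
      lam (R₀ / (Ran - R₀)) ≤ 4 / Real.pi * (R₀ / (Ran - R₀)) := by
  have hd' : 0 < Ran - R₀ := by linarith
  have hr0 : 0 < R₀ / (Ran - R₀) := div_pos hR₀ hd'
  have hr1 : R₀ / (Ran - R₀) < 1 := (div_lt_one hd').2 (by linarith)
  have h := rawEntryLetters_inv_at_member_realSlice hc35 q hq H 𝔬A κA hstA hκA h36A h261 loc sℓ ℓmax hsℓ hloc hlen x hM hα ha ℛ Uv
    hUv hslice hA hmA hacc hr0 hr1
  have e : R₀ / (Ran - R₀) / (1 + R₀ / (Ran - R₀)) * Ran = R₀ := by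
    field_simp
    ring
  rw [e] at h
  exact ⟨h, B13RealSliceEntryLetters.lam_radii_le hR₀.le h2⟩

/-- **THE DIRECT ROAD AT A MEMBER**: a complex family `Δ₀ : E → Matrix (X x) (X x) ℂ`, entrywise holomorphic with a rate-free bound `M_b`
on the ball, which at every real `v` IS `M((𝔬A x).G (Uv v))` (`hslice`) for a real family `Uv` valued in `Reg335 c₃₅ α₀` on the real slice;
`q.C d_q·(ℓmax x)² ≤ M_b` ⟹ `RawEntryLetters Δ₀` on the shrunken ball (55A §4 direct road at N06's conclusion per real `v`).
[cite: Balaban1985BackgroundPropagators, Thm 3.4 p.400, Thm 3.10 (3.107)–(3.108) p.416, (3.35) p.396; Balaban1988RG2Cluster, p.13, p.15; Ransford1995, Thm. 4.3.7] -/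
theorem rawEntryLetters_G_at_member_realSlice (hc35 : 0 < c35) (q : PinPrims) (hq : q.OK)
    (H : MemberY d ℓ hd hL b₀ b₁ Mstar → Prop)
    (𝔬A : ∀ x : MemberY d ℓ hd hL b₀ b₁ Mstar, Ops310 (geo9Y x) (bg x) (X x) (Y x) (ι x) (A x))
    (κA : MemberY d ℓ hd hL b₀ b₁ Mstar → Sizes310)
    (hstA : ∀ x, StaticOK310 (𝔬A x) q.ρ q.Nc q.N' q.NF q.Cℓ (κA x)) (hκA : ∀ x, (κA x).Bounded q.Kc)
    (h36A : ∀ x, q.M₁ ≤ (geo9Y x).M → ∀ α₀ : ℝ, 0 < α₀ → c35 * (geo9Y x).M * α₀ ≤ q.a₁ →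
      ∀ U : (bg x).Cfg, (bg x).Reg335 c35 α₀ U →
        Local342G (𝔬A x) 1 (H x) q.B₀ q.δ₀ U ∧ B9Thm310Whole.Factors389 (𝔬A x) 1 (H x) q.θ₀ q.δ₀ U ∧
          Identities310 (𝔬A x) 1 (H x) U)
    {ML : ℝ} (h261 : ∀ x, ML ≤ (geo9Y x).M →
      Ineq261 (exp261 (@geo9Y d ℓ hd hL b₀ b₁ Mstar) q.δ₀ q.α) (toB6 (geo9Y x) 1 (H x)) q.δ₀ q.α)
    (loc : ∀ x : MemberY d ℓ hd hL b₀ b₁ Mstar, (geo9Y x).Site → UT Nf) (sℓ ℓmax : MemberY d ℓ hd hL b₀ b₁ Mstar → ℝ)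
    (hsℓ : ∀ x, 0 ≤ sℓ x) (hloc : ∀ x a b, sℓ x * tdist1 Nf (loc x a) (loc x b) ≤ (geo9Y x).dist a b)
    (hlen : ∀ x a, (geo9Y x).len a ≤ ℓmax x)
    (x : MemberY d ℓ hd hL b₀ b₁ Mstar)
    (hM : max q.M₁ (max ML (max 1 (2 * q.NF * q.θ₀ * B6.c1 (exp261 (@geo9Y d ℓ hd hL b₀ b₁ Mstar) q.δ₀ q.α) q.δ₀ q.α))) ≤
      (geo9Y x).M)
    {α₀ : ℝ} (hα : 0 < α₀) (ha : (geo9Y x).M * α₀ ≤ q.a₁ / c35)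
    (ℛ : RealStructure E) (Uv : E → (bg x).Cfg) {Ran Mb r : ℝ} (hRan : 0 < Ran)
    (hUv : ∀ v ∈ ℛ.Ereal, ‖v‖ < Ran → (bg x).Reg335 c35 α₀ (Uv v))
    {Δ₀ : E → Matrix (X x) (X x) ℂ}
    (hslice : ∀ v ∈ ℛ.Ereal, ‖v‖ < Ran → Δ₀ v = (LinearMap.toMatrix' ((𝔬A x).G (Uv v))).map (algebraMap ℝ ℂ))
    (hholo : ∀ i j, DifferentiableOn ℂ (fun u => Δ₀ u i j) (ball (0 : E) Ran))
    (hMb : ∀ u ∈ ball (0 : E) Ran, ∀ i j, ‖Δ₀ u i j‖ ≤ Mb)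
    (hBM : q.C (exp261 (@geo9Y d ℓ hd hL b₀ b₁ Mstar) q.δ₀ q.α) * ℓmax x ^ 2 ≤ Mb) (hr0 : 0 < r) (hr1 : r < 1) :
    RawEntryLetters Δ₀ (loc x ∘ (𝔬A x).blk) (r / (1 + r) * Ran) ((1 - lam r) * ((((1 - 2 * q.α) * q.δ₀)) * sℓ x))
      ((q.C (exp261 (@geo9Y d ℓ hd hL b₀ b₁ Mstar) q.δ₀ q.α) * ℓmax x ^ 2) ^ (1 - lam r) * Mb ^ lam r) := by
  have hMq : q.M₁ ≤ (geo9Y x).M := le_trans (le_max_left _ _) hM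
  have hMLx : ML ≤ (geo9Y x).M := le_trans ((le_max_left _ _).trans (le_max_right _ _)) hM
  have hM1 : 1 ≤ (geo9Y x).M := le_trans (((le_max_left _ _).trans (le_max_right _ _)).trans (le_max_right _ _)) hM
  have hbig : 2 * q.NF * q.θ₀ * B6.c1 (exp261 (@geo9Y d ℓ hd hL b₀ b₁ Mstar) q.δ₀ q.α) q.δ₀ q.α ≤ (geo9Y x).M :=
    le_trans (((le_max_right _ _).trans (le_max_right _ _)).trans (le_max_right _ _)) hM
  have hMpos : 0 < (geo9Y x).M := lt_of_lt_of_le one_pos hM1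
  have haq : c35 * (geo9Y x).M * α₀ ≤ q.a₁ := by
    have h1 : c35 * ((geo9Y x).M * α₀) ≤ c35 * (q.a₁ / c35) := mul_le_mul_of_nonneg_left ha hc35.le
    rw [mul_div_cancel₀ _ hc35.ne'] at h1
    simpa only [mul_assoc] using h1
  have hq' : q.NF * (q.θ₀ * (geo9Y x).M⁻¹) * B6.c1 (exp261 (@geo9Y d ℓ hd hL b₀ b₁ Mstar) q.δ₀ q.α) q.δ₀ q.α ≤ 1 / 2 :=
    small_of_threshold hMpos hbig
  have hconv : ∀ v ∈ ℛ.Ereal, ‖v‖ < Ran →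
      Conv3107 (𝔬A x) 1 (H x) (q.C (exp261 (@geo9Y d ℓ hd hL b₀ b₁ Mstar) q.δ₀ q.α)) ((1 - 2 * q.α) * q.δ₀) (Uv v) := by
    intro v hv hvR
    obtain ⟨hl, hf, hi⟩ := h36A x hMq α₀ hα haq (Uv v) (hUv v hv hvR)
    exact conv3107_of_local3107 (𝔬A x) 1 (H x) (exp261 (@geo9Y d ℓ hd hL b₀ b₁ Mstar) q.δ₀ q.α) q.δ₀ q.α q.ρ q.B₀ q.Nc q.N'
      q.NF q.Cℓ q.Kc q.θ₀ (κA x) (Uv v) hq.B₀_pos.le hq.δ₀_pos.le hq.α_pos.le hq.α_lt.le hq.Nc_nn hq.N'_nn hq.NF_nn hq.one_le_Cℓ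
      hq.Kc_nn hq.θ₀_nn hMpos (hstA x) (hκA x) (h261 x hMLx) hq' hl hf hi
  exact rawEntryLetters_G_of_conv3107_realSlice_reading (𝔬A x) ℛ Uv hRan hconv (PinPrims.C_nonneg hq _) (PinPrims.rate_pos hq).le
    (fun a => (geo9Y_len_pos x a).le) (hlen x) (loc x) (hsℓ x) (hloc x) hslice hholo hMb hBM hr0 hr1

end Summit.QuantumFields.YangMills.BalabanUVNodes.N10EntryLettersOfN06RecordFace

end
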